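import Summits.NavierStokesRegularity.NavierStokesRegularity.Theorems.ApexLocalisation.Negative.LogicAndLoadBearing
import Summits.NavierStokesRegularity.NavierStokesRegularity.Theorems.ApexLocalisation.Negative.FinalSlice
import Summits.NavierStokesRegularity.NavierStokesRegularity.Theorems.ApexLocalisation.Negative.AEForm
import Summits.NavierStokesRegularity.NavierStokesRegularity.Theorems.ApexLocalisation.Negative.KinematicLoadBearing
import Summits.NavierStokesRegularity.NavierStokesRegularity.Theorems.ApexLocalisation.Negative.LinesVacuity
import Summits.NavierStokesRegularity.NavierStokesRegularity.Theorems.ApexLocalisation.Negative.LinesLoadBearing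
import Summits.NavierStokesRegularity.NavierStokesRegularity.Theorems.ApexLocalisation.Negative.BridgeTargets
import Summits.NavierStokesRegularity.NavierStokesRegularity.Cruxes.ApexLocalisation.SketchIdeator1
import Summits.NavierStokesRegularity.NavierStokesRegularity.Cruxes.ApexLocalisation.Ideator3Sketch

/-!
# Disproof of `ApexLocalisation` — findings (standing disprover, crux stmt-NavierStokesRegularity-11719, gen 3)

Crux (route `RellichScar`, rank 4):
`ApexLocalisation : ∀ C, (∃ (u,p,G), suitable weak on the slab (−∞,0)×ℝ³ ∧ weak gradient G ∧`
`𝐈(ℝ³×ℝ₋) < ⊤ ∧ RATE ‖u(t,x)‖ ≤ C/√(−t) ∧ (0,0) backward-singular) → ∃ C' (u,p,G), same with the`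
`SPACE–TIME bound ‖u(t,x)‖ ≤ C'/(‖x‖ + √(−t))` (KNSS 2009 (1.4) ⇒ (1.6) for SOME profile).

**VERDICT (gens 1–3): not refutable without constructing a Type-I blow-up of 3-D Navier–Stokes;
survives every cheap attack; its load-bearing hypotheses are certified.** Everything conclusive is
LANDED in the tree and importable (this file is an index + §9 + the `-- Targets` briefing):

| § | content | landed module (namespace `…Theorems.ApexLocalisation.Negative`) |
|---|---------|------------------------------------------------------------------|
| 0–2 | classes `IsRateProfile`/`IsApexProfile`; `¬crux ↔ RateProfileExists ∧ X`; `crux ∨ X`; `¬RateProfileExists ↔ X ∧ crux`; `¬crux → LocalTypeISingularityExists` (A–B first bullet, OPEN); LOAD-BEARING: `𝐈<⊤` dropped ⇒ crux ↔ ¬X (parasitic flow), Sing₀ dropped ⇒ crux ↔ ¬X (zero flow), rate dropped ⇒ stronger; every profile has `0 < C` | `Negative.LogicAndLoadBearing` (p70573) |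
| 3–5 | FINAL SLICE: rate ⇒ no singular point at `t<0`; `Σ(u)` closed; apex ⇒ `Σ={0}`; parasitic ⇒ `Σ=ℝ³`; TRANSLATION covariance ⇒ antecedent ⇔ "singular somewhere at `t ≤ 0`"; DICTIONARY apex ⇔ rate ∧ `sup ‖x‖‖u‖ < ∞`; REFUTED STRENGTHENINGS (orbit upgrade without `𝐈`, rate ⇒ apex pointwise) | `Negative.FinalSlice` (p70966) |
| 6b | a.e. form: `crux ↔ (AERateProfileExists → AEApexProfileExists)` (representatives free) | `Negative.AEForm` (p71178) |
| 6 | KINEMATICS: `X` false without the NS equations (explicit bump `χ(‖x‖²/(−t))/√(−t)·e₀`, `𝐈<⊤`); SWS load-bearing in the crux; fully kinematic crux TRUE | `Negative.KinematicLoadBearing` (p71223), `Literature…KinematicApexWitness` (p69758) |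
| lib | parasitic flow `C e₀/√(−t)`: suitable, rate, `Σ=ℝ³`, `𝐈=⊤`, self-similar, translation-invariant | `Literature.Analysis.FluidPDE.ParasiticSlabFlow` (p68502) |
| lib | a.e. → pointwise representatives in the rate/apex classes | `Literature.Analysis.FluidPDE.LocalTypeICongr` (p70667) |
| 9 | (THIS FILE §9) positive by-product: `ShellUniformityGivesApex` PROVED (C' = (max C 0 + 1)(θ⁻¹ + 1)) + trivial converse | evidence only (prover may land with --supports) |
| 10 | (gen 3) the LINES' first lemmas: (L)-vacuity of every universal stub over `RateClassSingular`, ∃-stubs exhibit Type-I singularities; quantum / confinement / final-slice sparsity FALSE without `𝐈 ≤ M`, quantum false without Sing₀, "∃ active point" false over `InRateClass` (zero flow) | `Negative.LinesVacuity` (p71858), `Negative.LinesLoadBearing` (p72130) |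
| T | (gen 3, `-- Targets`, picked line `decaying-ancient-bridge`) class 𝒜(C,B) verbatim (`InBridgeClass`), zero ∈ 𝒜, degenerate hull directions (zoom-in / far-past) give only `N = 0`, glue (bound + rate inherited), (L)-vacuity BY NAME of `stub_hullSelection` / `stub_apexOfDecaying` via A–B reverse WITHOUT mildness | `Negative.BridgeTargets` (p72645), `Negative.BridgeVacuity` (p73183), `Literature…LocalTypeIReverseSuitable` (p72407) |

## §7 Why it resists (for ideators / planners / the lead)

* A refutation = `RateProfileExists ∧ X`: a Type-I singular suitable weak solution (none known; empty
  under the KNSS Liouville conjecture (L), which makes the crux vacuously TRUE) AND the route target.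
* Nearest finiteness prints need more than the rate: finite/structured final-time singular sets are
  proved under `L^∞_t L^{3,∞}_x` (Choe–Wolf–Yang 2019/20; Barker arXiv:2111.14776 Thm 2: `O(M^20)`
  points; Seregin arXiv:1906.06707) or `L^{q,∞}_t L^p_x`, `3/p + 2/q = 1`, `3 < p < ∞` (Wang–Zhang
  arXiv:1201.1100 Thm 5.3, p. 9) — the crux antecedent is exactly the EXCLUDED endpoint `(p,q) = (∞,2)`,
  where `A ≤ 𝐈` only bounds the number of bad `r`-balls in `B_R` by `𝐈R/(εr)` (dimension ≤ 1, CKN).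
  KNSS 2009 upgrade (1.4) ⇒ (1.6) exists only under AXISYMMETRY. No 2019–2026 print closes the gap
  (searched gens 1–3).
* Barrier (technique): Scheffer 1987 / Ożański (tree `Literature.Barriers.NavierStokesRegularity.
  NavierStokesInequalitySingularSolutions`): Navier–Stokes-INEQUALITY fields have the rate, DSS scaling,
  summable `𝐈`-type quantities and a CANTOR final-time singular set — so "final-slice sparsity ⇒
  isolation" is false in the LEI + ε-regularity + scaling class; a proof must use the equations
  (backward uniqueness / unique continuation, or an `L^{3,∞}`-type upgrade of the rate class).
* Kinematically nothing helps either way (§6): the function classes are consistent with `Σ = {0}`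
  (bump) and, without `𝐈`, with `Σ = ℝ³` (parasitic); isolation must come from the dynamics.

## §10 (gen 3) What the disprover can and cannot kill among the LINES' stubs — see the theorems below

Every universal stub `∀ (u,p,G) ∈ RateClassSingular C M, …` (quantum, tolerance criterion,
genealogy, clean trunks, …) is implied by `¬ RateProfileExists`, hence irrefutable short of Type-I
blow-up; every unguarded existential stub `∃ (u,p,G) ∈ RateClassSingular C M, …` ("the band infimum
is attained") proves A–B's open first bullet. So only MIS-STATEMENTS are killable: the theorems of
§10 list the fatal omissions found so far (`𝐈 ≤ M` in the quantum, in `ConfinementImpliesApex`, in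
`FinalSliceRadialNull`; the singular origin in the quantum). Stub authors: keep `typeIBound ≤ M` and
`IsBackwardSingularPoint u 0` in every hypothesis class, guard every `∃`-stub by class non-emptiness,
and quantify `∀ L` (not `∃ L(M,C)`) in hereditary statements (triage r1-1/2/3).

## References

* G. Koch, N. Nadirashvili, G. Seregin, V. Šverák, Acta Math. 203 (2009). [KNSS2009]
* D. Albritton, T. Barker, J. Math. Fluid Mech. 21 (2019) = arXiv:1811.00502. [AlbrittonBarker2019]
* L. Caffarelli, R. Kohn, L. Nirenberg, CPAM 35 (1982). [CaffarelliKohnNirenberg1982]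
* W. Wang, Z. Zhang, arXiv:1201.1100, Thm 5.3. H. J. Choe, J. Wolf, M. Yang, Math. Ann. (2020).
  T. Barker, arXiv:2111.14776. G. Seregin, arXiv:1906.06707. W. Ożański, arXiv:1809.02109; V. Scheffer, CMP 110 (1987).
-/

noncomputable section

open MeasureTheory TopologicalSpace Set Function Filter Topology Metric
open scoped InnerProductSpace RealInnerProductSpace ENNReal NNReal
open Literature.Analysis.FluidPDE
open Summit.NavierStokesRegularity.NavierStokesRegularity.Theses
open Summit.NavierStokesRegularity.NavierStokesRegularity.Theorems.ApexLocalisation.Negative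
open Summit.NavierStokesRegularity.NavierStokesRegularity.Cruxes.ApexLocalisation

set_option linter.dupNamespace false

namespace Summit.NavierStokesRegularity.NavierStokesRegularity.Cruxes.ApexLocalisation.Disproof

/-- Physical space. -/
local notation "ℝ³" => EuclideanSpace ℝ (Fin 3)

/-- The open backward slab `(-∞,0) × ℝ³` (time first), as in the route file. -/
local notation "𝕊" => Literature.Analysis.FluidPDE.slab (EuclideanSpace ℝ (Fin 3)) (Set.Iio (0 : ℝ)) isOpen_Iio

/-! ## §1–§6 (landed): the API a line may cite, checked to resolve -/

/-- ¬crux ↔ (a rate profile exists) ∧ X. -/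
example : ¬ RellichScar.ApexLocalisation ↔ (RateProfileExists ∧ RellichScar.NoApexTypeIProfile) :=
  not_apexLocalisation_iff

/-- crux ∨ X; ¬RateProfileExists (stmt-1588) ↔ X ∧ crux. -/
example : RellichScar.ApexLocalisation ∨ RellichScar.NoApexTypeIProfile := apexLocalisation_or_target

example : ¬ RateProfileExists ↔ (RellichScar.NoApexTypeIProfile ∧ RellichScar.ApexLocalisation) :=
  not_rateProfileExists_iff_target_and_crux

/-- A disproof would settle Albritton–Barker's open first bullet positively. -/
example (h : ¬ RellichScar.ApexLocalisation) : LocalTypeISingularityExists :=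
  localTypeISingularityExists_of_not_apexLocalisation h

/-- Load-bearing: `𝐈 < ⊤`, the singular origin, the NS equations — each dropped ⇒ crux ↔ ¬X. -/
example : ApexLocalisationWithoutI ↔ ¬ RellichScar.NoApexTypeIProfile := apexLocalisationWithoutI_iff_not_target

example : ApexLocalisationWithoutSing ↔ ¬ RellichScar.NoApexTypeIProfile :=
  apexLocalisationWithoutSing_iff_not_target

example : ApexLocalisationWithoutSWS ↔ ¬ RellichScar.NoApexTypeIProfile :=
  apexLocalisationWithoutSWS_iff_not_target

/-- Final slice: the crux is an isolation statement (`Σ = {0}` for apex, `Σ = ℝ³` for parasitic). -/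
example {C : ℝ} {u : ℝ → ℝ³ → ℝ³} {p : ℝ → ℝ³ → ℝ} {G : ℝ → ℝ³ → ℝ³ →L[ℝ] ℝ³}
    (h : IsApexProfile C u p G) : finalSliceSingularSet u = {0} :=
  finalSliceSingularSet_eq_of_apex h

example {C : ℝ} (hC : 0 < C) : finalSliceSingularSet (parasiticVelocity C) = univ :=
  finalSliceSingularSet_parasitic hC

/-- Dictionary / flexible antecedent / a.e. form. -/
example : RellichScar.ApexLocalisation ↔
    (RateProfileExists → ∃ (C : ℝ) (u : ℝ → ℝ³ → ℝ³) (p : ℝ → ℝ³ → ℝ) (G : ℝ → ℝ³ → ℝ³ →L[ℝ] ℝ³)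
      (K : ℝ), IsRateProfile C u p G ∧ ∀ t < 0, ∀ x, ‖x‖ * ‖u t x‖ ≤ K) :=
  apexLocalisation_iff_spatialBound

example : RellichScar.ApexLocalisation ↔ (AERateProfileExists → AEApexProfileExists) :=
  apexLocalisation_iff_ae

/-- Kinematics: the fully kinematic crux holds; X is false without the equations. -/
example := kinematicCrux_holds

example := target_false_without_SWS

/-! ## §10 (gen 3, LANDED) The lines' first lemmas: (L)-vacuity and load-bearing hypotheses

All of §10 is now in the tree (namespace `…Theorems.ApexLocalisation.Negative`; the `Theorems/` copies of the
ideators' statements live under `…Negative.Lines` and are definitionally the originals — see the `Iff.rfl`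
examples in the `-- Targets` block below):

* `Negative/LinesVacuity.lean` (p71858): `rateProfileExists_iff_exists_rateClassSingular`,
  `forall_rateClassSingular_of_not_rateProfileExists` (EVERY universal stub over `RateClassSingular` is
  (L)-vacuous), `localTypeISingularityExists_of_exists_rateClassSingular` (every ∃-stub exhibits a Type-I
  singularity), `annularDissipationQuantum(Exists)_of_not_rateProfileExists`,
  `lowDissipationIsolation_of_not_rateProfileExists`, `quantumLine_of_not_localTypeISingularityExists`.
* `Negative/LinesLoadBearing.lean` (p72130): `annularDissipationQuantum_false_without_I` (parasitic flow,
  `∇u = 0`), `annularDissipationQuantum_false_without_Sing` (zero flow), `annularDissipationQuantum_of_nonpos`,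
  `AnnularDissipationQuantum.anti/anti_M/anti_C`; `confinementImpliesApex_false_without_I` (small parasitic
  flow `a = min η 1`: η-confined, rate 1, no a.e. apex bound on `(−1,−¼)×B₁(x₀)`);
  `finalSliceRadialNull_false_without_I` (`Σ = ℝ³`, radial image `[0,∞)`); `activeSet`, `inRateClass_zero`,
  `not_forall_inRateClass_exists_active` ("∃ an active point" must be ASSUMED over `InRateClass`: zero flow),
  `not_rateClassSingular_zero`.

Stub authors: keep `typeIBound ≤ M` and `IsBackwardSingularPoint u 0` in every hypothesis class, guard every
`∃`-stub by class non-emptiness / non-triviality, quantify `∀ L` in hereditary statements. -/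

/-! ### §9 (positive by-product, re-proved in gen 3 so that it is PUBLIC) Shell uniformity ⇒ apex

Gen 2 and triager r1-3 each proved the ideators' `ShellUniformityGivesApex` (card
`clock-mode-hyperbolicity`, used as the last step of `dissipation-quantum-tolerance` and of every
"isolation ⇒ apex by compactness" argument), but only inside evidence files that no seat can read.
Here it is again, against the original declaration; a prover may land it with `--supports`. -/

/-- **Shell uniformity ⇒ apex** (the ideators' `ShellUniformityGivesApex`, verbatim): if `u` has
the rate `C` and all zooms `u_λ` are bounded by `θ⁻¹` on the unit shell during `(-θ², 0)`, then
`u` has the space–time Type-I bound with `C' = (max C 0 + 1)(θ⁻¹ + 1)`. Inside the paraboloid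
`‖x‖ ≤ θ⁻¹√(−t)` the rate suffices; outside, the zoom `λ = ‖x‖` at `y = x/‖x‖`, `s = t/‖x‖²`
lands on the shell at an admissible time and gives `‖x‖‖u(t,x)‖ ≤ θ⁻¹`. -/
theorem shellUniformityGivesApex : ShellUniformityGivesApex := by
  intro u C θ hθ hrate hshell
  set K : ℝ := θ⁻¹ with hK
  have hK0 : 0 < K := inv_pos.2 hθ
  have hθK : θ * K = 1 := by rw [hK]; field_simp
  set C₀ : ℝ := max C 0 with hC₀
  have hC₀0 : 0 ≤ C₀ := le_max_right _ _
  have hCC₀ : C ≤ C₀ := le_max_left _ _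
  refine ⟨(C₀ + 1) * (K + 1), fun t ht x => ?_⟩
  have hst : 0 < Real.sqrt (-t) := Real.sqrt_pos.2 (by linarith)
  have hden : 0 < ‖x‖ + Real.sqrt (-t) := by positivity
  rw [le_div_iff₀ hden]
  by_cases hx : ‖x‖ ≤ K * Real.sqrt (-t)
  · -- inside the paraboloid: the rate suffices
    have h1 : ‖u t x‖ ≤ C₀ / Real.sqrt (-t) :=
      (hrate t ht x).trans (div_le_div_of_nonneg_right hCC₀ hst.le)
    rw [le_div_iff₀ hst] at h1
    -- h1 : ‖u t x‖ * √(-t) ≤ C₀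
    calc ‖u t x‖ * (‖x‖ + Real.sqrt (-t)) ≤ ‖u t x‖ * ((K + 1) * Real.sqrt (-t)) := by
          apply mul_le_mul_of_nonneg_left _ (norm_nonneg _)
          linarith
      _ = (‖u t x‖ * Real.sqrt (-t)) * (K + 1) := by ring
      _ ≤ C₀ * (K + 1) := mul_le_mul_of_nonneg_right h1 (by linarith)
      _ ≤ (C₀ + 1) * (K + 1) := by nlinarith
  · -- outside: zoom λ = ‖x‖ onto the unit shell
    push Not at hx
    have hxpos : 0 < ‖x‖ := lt_of_le_of_lt (by positivity) hx
    set s : ℝ := t / ‖x‖ ^ 2 with hs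
    set y : ℝ³ := ‖x‖⁻¹ • x with hy
    have hy1 : ‖y‖ = 1 := by
      rw [hy, norm_smul, norm_inv, norm_norm, inv_mul_cancel₀ hxpos.ne']
    have hs0 : s < 0 := div_neg_of_neg_of_pos ht (by positivity)
    have h2 : Real.sqrt (-t) < θ * ‖x‖ := by
      have := mul_lt_mul_of_pos_left hx hθ
      rwa [← mul_assoc, hθK, one_mul] at this
    have h3 : -t < (θ * ‖x‖) ^ 2 := by
      nlinarith [h2, hst.le, Real.sq_sqrt (show (0 : ℝ) ≤ -t by linarith)]
    have hsθ : -θ ^ 2 < s := by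
      rw [hs, lt_div_iff₀ (by positivity)]
      nlinarith [h3]
    have key := hshell ‖x‖ hxpos s hsθ hs0 y (by rw [hy1]) (by rw [hy1]; norm_num)
    rw [nsRescale_apply, norm_smul, Real.norm_of_nonneg hxpos.le] at key
    have e1 : ‖x‖ ^ 2 * s = t := by
      rw [hs]; field_simp
    have e2 : ‖x‖ • y = x := by
      rw [hy, smul_smul, mul_inv_cancel₀ hxpos.ne', one_smul]
    rw [e1, e2] at key
    -- key : ‖x‖ * ‖u t x‖ ≤ θ⁻¹ = K
    have hsqrt_le : Real.sqrt (-t) * K ≤ ‖x‖ := by nlinarith [hx]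
    calc ‖u t x‖ * (‖x‖ + Real.sqrt (-t))
        = ‖u t x‖ * ‖x‖ + ‖u t x‖ * Real.sqrt (-t) := by ring
      _ ≤ K + ‖u t x‖ * Real.sqrt (-t) := by nlinarith [key, norm_nonneg (u t x)]
      _ ≤ K + 1 := by
          -- ‖u‖ √(-t) ≤ ‖u‖ ‖x‖ / K ≤ K / K = 1
          have hu0 : 0 ≤ ‖u t x‖ := norm_nonneg _
          have h4 : ‖u t x‖ * Real.sqrt (-t) * K ≤ K := by
            calc ‖u t x‖ * Real.sqrt (-t) * K = ‖u t x‖ * (Real.sqrt (-t) * K) := by ring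
              _ ≤ ‖u t x‖ * ‖x‖ := mul_le_mul_of_nonneg_left hsqrt_le hu0
              _ = ‖x‖ * ‖u t x‖ := mul_comm _ _
              _ ≤ K := by simpa [hK] using key
          have h5 : ‖u t x‖ * Real.sqrt (-t) ≤ 1 := by
            by_contra hcon
            push Not at hcon
            have : K < ‖u t x‖ * Real.sqrt (-t) * K := by nlinarith
            linarith
          linarith
      _ ≤ (C₀ + 1) * (K + 1) := by nlinarith

/-- Trivial converse direction used by the lines: an apex bound gives shell uniformity with
`θ⁻¹ ≥ C'` (indeed `‖u_λ(t,x)‖ ≤ C'/(‖x‖ + √(−t)) ≤ C'` on `‖x‖ ≥ 1`). -/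
theorem shell_bound_of_hasTypeIDecay {C' : ℝ} {u : ℝ → ℝ³ → ℝ³} (h : HasTypeIDecay C' u)
    {lam : ℝ} (hlam : 0 < lam) {t : ℝ} (ht : t < 0) {x : ℝ³} (hx : 1 ≤ ‖x‖) :
    ‖nsRescale lam u t x‖ ≤ C' := by
  have key := (h.nsRescale hlam) t ht x
  have hC : 0 ≤ C' := nonneg_of_hasTypeIDecay h
  refine key.trans ?_
  rw [div_le_iff₀ (by positivity)]
  nlinarith [Real.sqrt_nonneg (-t)]

/-! ## -- Targets (gen 3): the PICKED line `decaying-ancient-bridge` (lead prover-line-…-11719-0,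
`Cruxes/ApexLocalisation/Lines/decaying-ancient-bridge.lean`, 6 registered stubs, PICKED.md 2026-08-16T00:15Z)

Per-stub verdict of the standing disprover (proofs: `Negative/BridgeTargets.lean`, proposed; Literature
`LocalTypeIReverseSuitable.lean`, p72407 ACCEPTED):

* `stub_slabCompactness` (ENGINE, A–B Lemma 2.2 + Prop 2.3 on the slab): TRUE known mathematics; no
  junk found (the `∃ σ` lets the prover extract pressure convergence too, which persistence needs; `4I`
  from separate lsc of `A,C,D,E` is right; `∪_R Q(0,R)` is the whole slab). Not a disprover target.
* `stub_rateToAncient` (⇒ TRANSFER): antecedent = `RateProfileExists` ⇒ (L)-VACUOUS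
  (`Negative/LogicAndLoadBearing`); irrefutable. Content check: the rate is inherited with the SAME `C`
  exactly because the rescaling centres have `t_k ≤ 0` (`Negative/BridgeTargets.hasTypeITimeDecay_hull`);
  `B = 1` by normalisation; non-triviality of the limit needs the uniform Hölder modulus of bounded mild
  solutions near the vertex (KNSS), since `|v_k(0,0)| ≥ 1/2` sits ON the final slice.
* `stub_radiationBound` (UNCONDITIONAL estimate): TRUE; no junk that hurts (non-integrable Bochner
  integrands evaluate to `0`, which only helps an upper bound; `I = 0` forces `M ≡ 0`; `B < 0` is
  vacuous; the bound is uniform in `B` as it must be). Constants for the lead: kernel bound (14)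
  `‖K(θ,ζ)[a,a]‖ ≤ c_K ‖a‖²/(‖ζ‖+√θ)⁴`; shells `r_k = 2^k‖x‖/2 ≤ ‖y−x‖ < r_{k+1}`, shell mass
  `∫ ‖M‖² ≤ 2 I r_k` from the ball `B(x,2r_k)`; `∫₀^∞ (ρ+√θ)⁻⁴ dθ = 1/(3ρ²)`; `Σ_k 1/r_k = 4/‖x‖`; so
  `c₀ = 8 c_K/3` works, uniformly in the window `(s,t)`.
* `stub_hullSelection` (THE BET): quantifies over NON-TRIVIAL members of 𝒜(C,B), which are Type-I
  singularities (`localTypeISingularityExists_of_inBridgeClass_nontrivial`, via A–B Thm 1.1 reverse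
  WITHOUT mildness, Literature `localTypeISingularityExists_of_suitable_nontrivial'`) ⇒ (L)-VACUOUS,
  indeed a THEOREM under `¬LocalTypeISingularityExists` (`hullSelection_of_not_localTypeI`); irrefutable
  short of a Type-I blow-up. STRUCTURE (proved): the zero field is in 𝒜(C,B) (`inBridgeClass_zero`) — the
  non-triviality guard is load-bearing; zoom-ins `λ_k → 0` of a bounded field and far-past shifts
  `t_k → −∞` of a rate field have only the ZERO limit (`hullLimit_eq_zero_of_tendsto_zero/_atBot`,
  `not_tendsto_of_hullLimit_nontrivial`) — so the bet's witnesses are, modulo subsequences, SPATIAL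
  TRANSLATES `‖x_k‖ → ∞` (plus `λ ∈ [λ₀,1]`, bounded `t_k`): "follow a far core to spatial infinity and
  find a single `K/‖y‖` core". Its negation = a non-trivial 𝒜-member all of whose translation limits
  keep Type-I activity at unbounded parabolic distance ("daughter gas") — the crux's own obstruction.
* `stub_hullClosed`: over non-trivial `M` (L)-vacuous; at `M ≡ 0` true (`hullLimit_zero_field`). Glue
  proved: `norm_hull_le`, `hasTypeITimeDecay_hull` (`λ_k ≤ 1`, `t_k ≤ 0` are exactly what is needed).
* `stub_apexOfDecaying` (⇐ TRANSFER): antecedent (non-trivial decaying suitable slab solution with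
  `𝐈 < ⊤`) is a Type-I singularity (`localTypeISingularityExists_of_decayingAntecedent`); a THEOREM
  under `¬LocalTypeISingularityExists` (`apexOfDecaying_of_not_localTypeI`); otherwise it is the honest
  blow-down (`c C'/(1+c‖x‖+c√−t) ≤ C'/(‖x‖+√−t)` exactly). Irrefutable.

Bottom line for the lead: nothing in the skeleton is killable; all open content is in
`stub_hullSelection`, which is exactly as strong as the crux in the Type-I world.

CONCURRENCE (drefute seat, `Cruxes/ApexLocalisation/Lines/decaying-ancient-bridge-drefute.md` +
`Cruxes/ApexLocalisation/DrefuteDAB.lean`, 2026-08-16T00:45Z, read 00:50Z): same six verdicts reached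
independently over the inlined class (`DrefuteDAB.inClass_zero_iff`, `…_of_not_nontrivial` certificates via
A–B's second bullet `NontrivialMildAncientTypeIExists`; here via the first bullet without mildness). Used
from it: (i) in `stub_radiationBound` the hypotheses `0 ≤ I` (implied by the Morrey bound at any `r > 0`) and
`‖M‖ ≤ B` (not used by the estimate) are redundant; same constant in the tree's normalisation
`c₀ = (32/3)·oseenKernelBoundConst`; (ii) its SHARPEN: the hull of `stub_hullSelection`/`stub_hullClosed` may
be ENLARGED for free to all `λ_k > 0` with an explicit uniform bound `B'` of the hull images (the rate is
inherited for every `λ > 0` once `t_k ≤ 0` — `hasTypeITimeDecay_hull` above has no `λ ≤ 1` hypothesis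
either), which gives the bet room to normalise "big weak far blobs" (size `ℓ_k → ∞`, amplitude `~1/ℓ_k`,
kinematically compatible with `𝐈 < ∞`) that the restricted hull cannot see. -/

/-! ### -- Targets: the landed lemmas, checked to resolve (`Negative/BridgeTargets`; `Negative/BridgeVacuity` (p73183,
landed) is not imported here only because of farm build lag at publication time) -/

/-- The ideators'/lead's class and the disprover's copies agree definitionally. -/
example (C M : ℝ) (u : ℝ → ℝ³ → ℝ³) (p : ℝ → ℝ³ → ℝ) (G : ℝ → ℝ³ → ℝ³ →L[ℝ] ℝ³) :
    RateClassSingular C M u p G ↔ Lines.RateClassSingular C M u p G := Iff.rfl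

example : AnnularDissipationQuantumExists ↔ Lines.AnnularDissipationQuantumExists := Iff.rfl

example : LowDissipationIsolation ↔ Lines.LowDissipationIsolation := Iff.rfl

example : Sketch.ConfinementImpliesApex ↔ Lines.ConfinementImpliesApex := Iff.rfl

example : Sketch.FinalSliceRadialNull ↔ Lines.FinalSliceRadialNull := Iff.rfl

/-- Zero field ∈ 𝒜(C,B); degenerate hull directions; (L)-vacuity of the bet by name. -/
example {C B : ℝ} (hC : 0 ≤ C) (hB : 0 ≤ B) : InBridgeClass C B 0 := inBridgeClass_zero hC hB

example := @not_tendsto_of_hullLimit_nontrivial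

example := @frequently_of_hullLimit_nontrivial

/-! ### -- Targets addendum: the degenerate direction of the ENLARGED hull (drefute SHARPEN) -/

/-- **Enlarged hull** (drefute SHARPEN: all `λ_k > 0`, no `λ_k ≤ 1`): the degenerate direction is
`t_k/λ_k² → −∞` — then every slice-wise pointwise limit of `λ_k M(t_k + λ_k² t, x_k + λ_k y)` vanishes,
by the rate ALONE (`‖λ M(t_k+λ²t,·)‖ ≤ λC/√(−t_k−λ²t) = C/√(−t_k/λ² − t) ≤ C/√(−t_k/λ²) → 0`); the
bound `B` is not needed. So in the enlarged hull non-trivial limits need `t_k/λ_k²` bounded below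
infinitely often. -/
theorem hullLimit_eq_zero_of_tendsto_div_atBot {M N : ℝ → ℝ³ → ℝ³} {C : ℝ}
    (hC : HasTypeITimeDecay C M) {xk : ℕ → ℝ³} {tk lk : ℕ → ℝ}
    (hadm : ∀ k, tk k ≤ 0 ∧ 0 < lk k) (h : Tendsto (fun k => tk k / lk k ^ 2) atTop atBot)
    (hconv : ∀ t < 0, ∀ y : ℝ³,
      Tendsto (fun k => lk k • M (tk k + lk k ^ 2 * t) (xk k + lk k • y)) atTop (𝓝 (N t y))) :
    ∀ t < 0, ∀ y : ℝ³, N t y = 0 := by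
  intro t ht y
  have hC0 : 0 ≤ max C 0 := le_max_right _ _
  have hev : ∀ᶠ k in atTop, tk k / lk k ^ 2 < 0 := h.eventually (eventually_lt_atBot 0)
  have h2 : Tendsto (fun k => lk k • M (tk k + lk k ^ 2 * t) (xk k + lk k • y)) atTop (𝓝 0) := by
    refine squeeze_zero_norm' (a := fun k => max C 0 / Real.sqrt (-(tk k / lk k ^ 2)))
      (hev.mono fun k hk => ?_) ?_
    · have hl0 := (hadm k).2
      have hl2 : 0 < lk k ^ 2 := pow_pos hl0 2
      have hneg : lk k ^ 2 * t < 0 := mul_neg_of_pos_of_neg hl2 ht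
      have htime : tk k + lk k ^ 2 * t < 0 := by linarith [(hadm k).1]
      -- `−t_k − λ²t = λ² (−t_k/λ² − t)` and `−t_k/λ² − t ≥ −t_k/λ² > 0`
      have hq : 0 < -(tk k / lk k ^ 2) := by linarith
      have hfac : -(tk k + lk k ^ 2 * t) = lk k ^ 2 * (-(tk k / lk k ^ 2) - t) := by
        field_simp
        ring
      have hsqrt : Real.sqrt (-(tk k + lk k ^ 2 * t)) = lk k * Real.sqrt (-(tk k / lk k ^ 2) - t) := by
        rw [hfac, Real.sqrt_mul (sq_nonneg _), Real.sqrt_sq hl0.le]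
      have hs1 : 0 < Real.sqrt (-(tk k / lk k ^ 2)) := Real.sqrt_pos.2 hq
      have hs2 : Real.sqrt (-(tk k / lk k ^ 2)) ≤ Real.sqrt (-(tk k / lk k ^ 2) - t) :=
        Real.sqrt_le_sqrt (by linarith)
      have hs3 : 0 < Real.sqrt (-(tk k / lk k ^ 2) - t) := lt_of_lt_of_le hs1 hs2
      rw [norm_smul, Real.norm_of_nonneg hl0.le]
      calc lk k * ‖M (tk k + lk k ^ 2 * t) (xk k + lk k • y)‖
          ≤ lk k * (max C 0 / Real.sqrt (-(tk k + lk k ^ 2 * t))) := by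
            apply mul_le_mul_of_nonneg_left _ hl0.le
            exact (hC _ htime _).trans
              (div_le_div_of_nonneg_right (le_max_left _ _) (Real.sqrt_nonneg _))
        _ = max C 0 / Real.sqrt (-(tk k / lk k ^ 2) - t) := by
            rw [hsqrt]
            field_simp
        _ ≤ max C 0 / Real.sqrt (-(tk k / lk k ^ 2)) := div_le_div_of_nonneg_left hC0 hs1 hs2
    · have hsqrt : Tendsto (fun k => Real.sqrt (-(tk k / lk k ^ 2))) atTop atTop :=
        Real.tendsto_sqrt_atTop.comp (tendsto_neg_atBot_atTop.comp h)
      exact tendsto_const_nhds.div_atTop hsqrt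
  exact tendsto_nhds_unique (hconv t ht y) h2

/-! ### §10e Near-misses / not attempted (docstring record; no sorries in this file)

* `Sketch.NoFinalTimeConcentration` is also false without `𝐈 ≤ M` (parasitic `u(t) → ∞`
  uniformly, no `L²_loc` scar) and without the NS equations (kinematic tube of width
  `(−t)^{1/2−δ}` around a segment concentrates `|u(t)|² dx ⇀ ℋ¹⌊segment` with `𝐈 < ⊤` and the
  rate) — not formalised (the `typeIBound < ⊤` bookkeeping of a tube witness is long; ask if needed).
* `Sketch.ConfinementImpliesApex` WITH `𝐈 ≤ M` is plausible-true (ancient + rate + Morrey ⇒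
  localized smoothing far out); `LowDissipationIsolation` is plausible-true pure accounting
  (mother quanta `Σ_j e r2^{-j} = 2er` tile `Q_r` in time; a companion at `|b| = s` adds
  `Σ_{ρ ≤ s/4} eρ = es/2` in disjoint regions inside `Q_{2s}` ⇒ `E(Q_{2s}) ≥ (9/4)e`) GIVEN the
  nsRescale/translation covariance of `RateClassSingular` (translation: `Negative/FinalSlice`;
  scaling: `LocalTypeIScaling`). Neither is a disprover target.
* The registered skeleton (2026-08-16T00:01Z) is `activity-genealogy-fission`
  (stubs `ContinuousRepresentative`, `ConfinementImpliesApex`, `Genealogy`, `CleanTrunkCompactness`,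
  `NoPerpetualFission`); its text is not published under `Cruxes/…/Lines/` (crux write refused to the
  planner seat), so only the sketch forms above could be attacked. When the lead publishes the
  skeleton, the `-- Targets` section of this file will address the stubs by name. -/

end Summit.NavierStokesRegularity.NavierStokesRegularity.Cruxes.ApexLocalisation.Disproof
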